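import Summits.QuantumFields.BalabanUV.Beta.D1BFx.OffDiagonalLegGrade

/-!
# `BalabanUV.Beta.D1BFx.DiagonalLegGrade` — road «BF-x» for binder row D1, leaf A3.c (part 3, the GRADED side of the A3 classes on `ℤ⁴`):
# the DIAGONAL entries `K^∞((x,κ),(x′,κ))` of the infinite-volume gluon propagator are THE FREE LEG `G₀(x′ − x)` PLUS A FLAT PART
# (`−n²·Re R⊥_{w,∞} + n²·Re 𝓛_∞`, lines 1–3 of B5 (1.83) at `U = 1`) carrying the WINDOW GRADE `D₀/n²`, `D₁/n³` (either end), `D₂/n⁴` (mixed)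
# on ALL of `ℤ⁴` — hence on the window `1 ≤ ‖w‖∞ ≤ n` the diagonal leg and its one-end difference are `Leg`-GRADED, `A/‖w‖∞²` and `A′/‖w‖∞³`,
# with `n`-FREE constants: the `hG` hypotheses (`b = 2, 3`) of `D1BFx.FlatGradedCount` for the ACTUAL diagonal leg

HONEST FRAMING (cell contract, verbatim): «discharging `BetaPertH` makes Bałaban's UV stability UNCONDITIONAL — a real constructive-QFT
result; it is NOT the continuum limit and NOT the Clay problem.»  This module is [folklore] bookkeeping BY NAME over the tree: an5's
`VectorPropagatorLimit.Kinf` / `Kinf_eq_of_repr` (representative independence), the `d = 4` window-grade packages of the two flat pieces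
`WoodburyBondSymbol.norm_RperpBLim_le` / `norm_dRperpBLim_le` / `norm_dRperpBLim'_le` / `norm_ddRperpBLim_le` (constants `woodburyDc/D1c/D2c 0`)
and `LongitudinalSymbol.norm_LkerLim_*` (`ellD0/1/2 4 a`), and the free legs of `BubbleTransfer` (`freeLeg`, `gradLegFwd` — Lawler–Limic /
Lawler (1.36) through the tree).  It cites nothing (the `[cite:]` tags live upstream), mints no `Prop`, defines nothing, discharges nothing of
the wall.  NOT summit progress; NOT D1, NOT BetaPertH, NOT continuum, NOT Clay.
HONEST DEPENDENCY (verbatim): «continuum YM on T⁴ ⇐ BetaPertH ∧ nine spine estimates (0/9 proved); BetaPertH ⇐ (D1) ∧ (D4) ∧ CAP+tail;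
G-an2-4 gates asym, D1 and NE2/3/4.»

WHY (skeleton `HOME/beta/skeletons/D1-b2b-balaban-beta-d1-p2.md` v1.4 node L, L1 «the scalar diagonal BF leg IS `GfE` = `Kinf` diagonal … window
rows (W2′)₀» and node A, A3 / A6: the REST-term counting on `ℤ⁴` (`FlatGradedCount`, `ContactCount`) needs n-UNIFORM entry and difference
bounds of the diagonal leg `Ga = Kinf` (leaf-09's XREAD INFO on `GluonLeg`: «the n-uniform ENTRY bound must come from the window rows, not from
`abs_Ga_le`» whose constant `n²/γ₀` grows).  `VectorLegVolumeAdapter` delivers the window rows in the TORUS-FAMILY shape `GS`/`gE` consumed by the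
existing END; this file delivers them ON `ℤ⁴`, for `Kinf` itself, directly from the limit symbols' bounds (no limit passage needed: `Kinf` is
DEFINED through `G₀`, `RperpBLim`, `LkerLim`).  Part 2 (`OffDiagonalLegGrade`) did the off-diagonal entries (pure line 3).
WHAT IS NOT DONE HERE: the MIXED second difference of the FREE part `G₀` (the `Leg` of degree 4 is CONDITIONAL on the printed shape of Lawler (1.37),
`BubbleTransfer.hessLegOfShape` — the consumer takes it there); the scale-`n` TAILS beyond the window ((α)-leaf [Balaban1984PropagatorsI] Prop. 1.2,
cited, unproved); nothing at `U ≠ 1`.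

CONTENT (all [folklore]; `d = 4`, block size `n ≥ 1`, weight `a > 0`, one component `κ`).
* §1 `Kinf_diag_eq(_left/_right/_both)` — the four diagonal entries `K^∞((x[+e_ρ],κ),(x′[+e_ρ′],κ))` as `G₀ + n²·Re(−R⊥_{w,∞} + 𝓛_∞)` on the COMMON
  representatives `repO/repS` (shifted by `bump`), via `Kinf_eq_of_repr`.
* §2 THE FLAT PART'S GRADES: **`abs_Kinf_diag_sub_G₀_le`** `|K^∞((x,κ),(x′,κ)) − G₀(x′−x)| ≤ (woodburyDc 0 + ellD0 4 a)/n²`;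
  **`abs_Kinf_diag_flat_sub_left_le`**, **`_sub_right_le`** (one difference at either end of the flat part) `≤ (woodburyD1c 0 + ellD1 4 a)/n³`;
  **`abs_Kinf_diag_flat_sub_sub_le`** (mixed) `≤ (woodburyD2c 0 + ellD2 4 a)/n⁴`.
* §3 PER BASE POINT `b`, DISPLACEMENT `w`, ON THE WINDOW `w ≠ 0`, `‖w‖∞ ≤ n`: **`abs_Kinf_diag_le_window`** `|K^∞((b,κ),(b+w,κ))| ≤ A₂/‖w‖∞²`
  (`A₂ = freeLeg.A + freeLeg.B + woodburyDc 0 + ellD0 4 a`) and **`abs_Kinf_diag_sub_disp_le_window`** (difference at the far end)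
  `≤ A₃/‖w‖∞³` (`A₃ = (gradLegFwd ρ).A + (gradLegFwd ρ).B + woodburyD1c 0 + ellD1 4 a`) — the `hG` shapes `b = 2`, `b = 3` of `FlatGradedCount`, n-FREE.
-/

namespace Summit.QuantumFields.BalabanUV.Beta.D1BFx.DiagonalLegGrade

open Literature.MathematicalPhysics.QuantumFieldTheory.Balaban1983to89
open Literature.MathematicalPhysics.QuantumFieldTheory.Balaban1983to89.Beta
open VectorPropagatorLimit (Kinf Kinf_eq_of_repr repO repS shv repO_cast repS_cast)
open LongitudinalSymbol (LkerLim norm_LkerLim_le norm_LkerLim_sub_left_le norm_LkerLim_sub_right_le norm_LkerLim_sub_sub_le)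
open LongitudinalWindow (ellD0 ellD1 ellD2)
open WoodburyBondSymbol (RperpBLim dRperpBLim dRperpBLim' ddRperpBLim norm_RperpBLim_le norm_dRperpBLim_le norm_dRperpBLim'_le
  norm_ddRperpBLim_le)
open WoodburyCovariant (woodburyDc woodburyD1c woodburyD2c)
open VectorLegVolumeAdapter (woodburyDc_zero_nonneg woodburyD1c_zero_nonneg woodburyD2c_zero_nonneg)
open PoissonInterior (G₀)
open DyadicShell (Pt supNorm)
open BubbleTransfer (freeLeg gradLegFwd Leg.abs_f_le Leg.one_le_supNorm)
open OffDiagonalLegGrade (cast_repO_add_single cast_repS_add_single ellD0_nonneg ellD1_nonneg ellD2_nonneg abs_sq_mul_re_le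
  sq_mul_div_pow_add_two)

/-! ## §0 Two arithmetic helpers -/

section Prelim

/-- [folklore] `|−n²·Re z₁ + n²·Re z₂| ≤ n²·(B₁ + B₂)` from `‖z₁‖ ≤ B₁`, `‖z₂‖ ≤ B₂`. -/
theorem abs_flat_le (n : ℕ) {z₁ z₂ : ℂ} {B₁ B₂ : ℝ} (h₁ : ‖z₁‖ ≤ B₁) (h₂ : ‖z₂‖ ≤ B₂) :
    |-(((n : ℕ) : ℝ) ^ 2 * z₁.re) + ((n : ℕ) : ℝ) ^ 2 * z₂.re| ≤ ((n : ℕ) : ℝ) ^ 2 * (B₁ + B₂) := by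
  have e : -(((n : ℕ) : ℝ) ^ 2 * z₁.re) + ((n : ℕ) : ℝ) ^ 2 * z₂.re = ((n : ℕ) : ℝ) ^ 2 * (z₂ - z₁).re := by
    rw [Complex.sub_re]; ring
  rw [e]
  refine (abs_sq_mul_re_le n (norm_sub_le z₂ z₁)).trans ?_
  exact mul_le_mul_of_nonneg_left (by linarith) (by positivity)

/-- [folklore] On the window `1 ≤ ‖w‖∞ ≤ n`: `C/n^k ≤ C/‖w‖∞^k` (`C ≥ 0`). -/
theorem div_pow_le_div_supNorm_pow {n : ℕ} {C : ℝ} (hC : 0 ≤ C) {w : Pt} (hw : w ≠ 0) (hwn : supNorm w ≤ n) (k : ℕ) :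
    C / (n : ℝ) ^ k ≤ C / (supNorm w : ℝ) ^ k := by
  have hs : (1 : ℝ) ≤ supNorm w := Leg.one_le_supNorm hw
  have hle : (supNorm w : ℝ) ≤ n := by exact_mod_cast hwn
  exact div_le_div_of_nonneg_left hC (by positivity) (pow_le_pow_left₀ (by linarith) hle k)

end Prelim

/-! ## §1 The four diagonal entries on common representatives -/

section Entries

variable (n : ℕ) [NeZero n] (hn : 1 ≤ n) (a : ℝ) (κ : Fin 4)
include hn

/-- [folklore] The diagonal entry: `K^∞((x,κ),(x′,κ)) = G₀(x′−x) − n²·Re R⊥_{w,∞}(X,X′) + n²·Re 𝓛_∞((X,κ),(X′,κ))` on the canonical representatives. -/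
theorem Kinf_diag_eq (x x' : Fin 4 → ℤ) :
    Kinf n a (x, κ) (x', κ) = G₀ (x' - x) - ((n : ℕ) : ℝ) ^ 2 * (RperpBLim n a 0 κ (repO n x x') (repS n x x')).re
      + ((n : ℕ) : ℝ) ^ 2 * (LkerLim n a (repO n x x') κ (repS n x x') κ).re := by
  rw [Kinf_eq_of_repr n a hn (x, κ) (x', κ) (repO_cast hn x x') (repS_cast hn x x'), if_pos rfl]

/-- [folklore] `K^∞((x+e_ρ,κ),(x′,κ))` on the representatives of the UNSHIFTED pair (`WoodburySymbol.bump ρ X = X + e_ρ`). -/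
theorem Kinf_diag_eq_left (ρ : Fin 4) (x x' : Fin 4 → ℤ) :
    Kinf n a (x + Pi.single ρ 1, κ) (x', κ) = G₀ (x' - (x + Pi.single ρ 1))
      - ((n : ℕ) : ℝ) ^ 2 * (RperpBLim n a 0 κ (WoodburySymbol.bump ρ (repO n x x')) (repS n x x')).re
      + ((n : ℕ) : ℝ) ^ 2 * (LkerLim n a (repO n x x' + Pi.single ρ 1) κ (repS n x x') κ).re := by
  rw [Kinf_eq_of_repr n a hn (x + Pi.single ρ 1, κ) (x', κ) (cast_repO_add_single hn x x' ρ) (repS_cast hn x x'), if_pos rfl]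
  rfl

/-- [folklore] `K^∞((x,κ),(x′+e_ρ′,κ))` on the representatives of the unshifted pair. -/
theorem Kinf_diag_eq_right (ρ' : Fin 4) (x x' : Fin 4 → ℤ) :
    Kinf n a (x, κ) (x' + Pi.single ρ' 1, κ) = G₀ (x' + Pi.single ρ' 1 - x)
      - ((n : ℕ) : ℝ) ^ 2 * (RperpBLim n a 0 κ (repO n x x') (WoodburySymbol.bump ρ' (repS n x x'))).re
      + ((n : ℕ) : ℝ) ^ 2 * (LkerLim n a (repO n x x') κ (repS n x x' + Pi.single ρ' 1) κ).re := by
  rw [Kinf_eq_of_repr n a hn (x, κ) (x' + Pi.single ρ' 1, κ) (repO_cast hn x x') (cast_repS_add_single hn x x' ρ'), if_pos rfl]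
  rfl

/-- [folklore] `K^∞((x+e_ρ,κ),(x′+e_ρ′,κ))` on the representatives of the unshifted pair. -/
theorem Kinf_diag_eq_both (ρ ρ' : Fin 4) (x x' : Fin 4 → ℤ) :
    Kinf n a (x + Pi.single ρ 1, κ) (x' + Pi.single ρ' 1, κ) = G₀ (x' + Pi.single ρ' 1 - (x + Pi.single ρ 1))
      - ((n : ℕ) : ℝ) ^ 2 * (RperpBLim n a 0 κ (WoodburySymbol.bump ρ (repO n x x')) (WoodburySymbol.bump ρ' (repS n x x'))).re
      + ((n : ℕ) : ℝ) ^ 2 * (LkerLim n a (repO n x x' + Pi.single ρ 1) κ (repS n x x' + Pi.single ρ' 1) κ).re := by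
  rw [Kinf_eq_of_repr n a hn (x + Pi.single ρ 1, κ) (x' + Pi.single ρ' 1, κ) (cast_repO_add_single hn x x' ρ)
    (cast_repS_add_single hn x x' ρ'), if_pos rfl]
  rfl

end Entries

/-! ## §2 The flat part `K^∞ − G₀` and its window grades (all of `ℤ⁴`) -/

section Flat

variable (n : ℕ) [NeZero n] (hn : 1 ≤ n) {a : ℝ} (ha : 0 < a) (κ : Fin 4)
include hn ha

/-- [folklore] **(D0)** `|K^∞((x,κ),(x′,κ)) − G₀(x′−x)| ≤ (woodburyDc 0 + ellD0 4 a)/n²` — the diagonal leg is the free leg up to a FLAT `n⁻²`. -/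
theorem abs_Kinf_diag_sub_G₀_le (x x' : Fin 4 → ℤ) :
    |Kinf n a (x, κ) (x', κ) - G₀ (x' - x)| ≤ (woodburyDc 0 + ellD0 4 a) / (n : ℝ) ^ 2 := by
  rw [Kinf_diag_eq n hn a κ]
  have e : G₀ (x' - x) - ((n : ℕ) : ℝ) ^ 2 * (RperpBLim n a 0 κ (repO n x x') (repS n x x')).re
      + ((n : ℕ) : ℝ) ^ 2 * (LkerLim n a (repO n x x') κ (repS n x x') κ).re - G₀ (x' - x)
      = -(((n : ℕ) : ℝ) ^ 2 * (RperpBLim n a 0 κ (repO n x x') (repS n x x')).re)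
        + ((n : ℕ) : ℝ) ^ 2 * (LkerLim n a (repO n x x') κ (repS n x x') κ).re := by ring
  rw [e]
  refine (abs_flat_le n (norm_RperpBLim_le n hn ha le_rfl κ _ _) (norm_LkerLim_le n (by norm_num) hn ha _ κ _ κ)).trans ?_
  rw [← add_div, show ((n : ℝ)) ^ (4 : ℕ) = (n : ℝ) ^ (2 + 2) from rfl, sq_mul_div_pow_add_two]

/-- [folklore] **(D1, near end)** one difference AT `x` of the flat part: `≤ (woodburyD1c 0 + ellD1 4 a)/n³`. -/
theorem abs_Kinf_diag_flat_sub_left_le (ρ : Fin 4) (x x' : Fin 4 → ℤ) :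
    |(Kinf n a (x + Pi.single ρ 1, κ) (x', κ) - G₀ (x' - (x + Pi.single ρ 1))) - (Kinf n a (x, κ) (x', κ) - G₀ (x' - x))| ≤
      (woodburyD1c 0 + ellD1 4 a) / (n : ℝ) ^ 3 := by
  rw [Kinf_diag_eq_left n hn a κ, Kinf_diag_eq n hn a κ]
  have e : G₀ (x' - (x + Pi.single ρ 1))
        - ((n : ℕ) : ℝ) ^ 2 * (RperpBLim n a 0 κ (WoodburySymbol.bump ρ (repO n x x')) (repS n x x')).re
        + ((n : ℕ) : ℝ) ^ 2 * (LkerLim n a (repO n x x' + Pi.single ρ 1) κ (repS n x x') κ).re - G₀ (x' - (x + Pi.single ρ 1))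
        - (G₀ (x' - x) - ((n : ℕ) : ℝ) ^ 2 * (RperpBLim n a 0 κ (repO n x x') (repS n x x')).re
          + ((n : ℕ) : ℝ) ^ 2 * (LkerLim n a (repO n x x') κ (repS n x x') κ).re - G₀ (x' - x))
      = -(((n : ℕ) : ℝ) ^ 2 * (dRperpBLim n a 0 κ ρ (repO n x x') (repS n x x')).re)
        + ((n : ℕ) : ℝ) ^ 2 * (LkerLim n a (repO n x x' + Pi.single ρ 1) κ (repS n x x') κ - LkerLim n a (repO n x x') κ (repS n x x') κ).re := by
    simp only [dRperpBLim, Complex.sub_re]; ring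
  rw [e]
  refine (abs_flat_le n (norm_dRperpBLim_le n hn ha le_rfl κ ρ _ _) (norm_LkerLim_sub_left_le n (by norm_num) hn ha ρ _ κ _ κ)).trans ?_
  rw [← add_div, show ((n : ℝ)) ^ (5 : ℕ) = (n : ℝ) ^ (3 + 2) from rfl, show ((n : ℝ)) ^ (4 + 1 : ℕ) = (n : ℝ) ^ (3 + 2) from rfl,
    sq_mul_div_pow_add_two]

/-- [folklore] **(D1, far end)** one difference AT `x′` of the flat part: `≤ (woodburyD1c 0 + ellD1 4 a)/n³`. -/
theorem abs_Kinf_diag_flat_sub_right_le (ρ' : Fin 4) (x x' : Fin 4 → ℤ) :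
    |(Kinf n a (x, κ) (x' + Pi.single ρ' 1, κ) - G₀ (x' + Pi.single ρ' 1 - x)) - (Kinf n a (x, κ) (x', κ) - G₀ (x' - x))| ≤
      (woodburyD1c 0 + ellD1 4 a) / (n : ℝ) ^ 3 := by
  rw [Kinf_diag_eq_right n hn a κ, Kinf_diag_eq n hn a κ]
  have e : G₀ (x' + Pi.single ρ' 1 - x)
        - ((n : ℕ) : ℝ) ^ 2 * (RperpBLim n a 0 κ (repO n x x') (WoodburySymbol.bump ρ' (repS n x x'))).re
        + ((n : ℕ) : ℝ) ^ 2 * (LkerLim n a (repO n x x') κ (repS n x x' + Pi.single ρ' 1) κ).re - G₀ (x' + Pi.single ρ' 1 - x)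
        - (G₀ (x' - x) - ((n : ℕ) : ℝ) ^ 2 * (RperpBLim n a 0 κ (repO n x x') (repS n x x')).re
          + ((n : ℕ) : ℝ) ^ 2 * (LkerLim n a (repO n x x') κ (repS n x x') κ).re - G₀ (x' - x))
      = -(((n : ℕ) : ℝ) ^ 2 * (dRperpBLim' n a 0 κ ρ' (repO n x x') (repS n x x')).re)
        + ((n : ℕ) : ℝ) ^ 2 * (LkerLim n a (repO n x x') κ (repS n x x' + Pi.single ρ' 1) κ - LkerLim n a (repO n x x') κ (repS n x x') κ).re := by
    simp only [dRperpBLim', Complex.sub_re]; ring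
  rw [e]
  refine (abs_flat_le n (norm_dRperpBLim'_le n hn ha le_rfl κ ρ' _ _) (norm_LkerLim_sub_right_le n (by norm_num) hn ha ρ' _ κ _ κ)).trans ?_
  rw [← add_div, show ((n : ℝ)) ^ (5 : ℕ) = (n : ℝ) ^ (3 + 2) from rfl, show ((n : ℝ)) ^ (4 + 1 : ℕ) = (n : ℝ) ^ (3 + 2) from rfl,
    sq_mul_div_pow_add_two]

/-- [folklore] **(D2, mixed)** one difference at each end of the flat part: `≤ (woodburyD2c 0 + ellD2 4 a)/n⁴`. -/
theorem abs_Kinf_diag_flat_sub_sub_le (ρ ρ' : Fin 4) (x x' : Fin 4 → ℤ) :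
    |((Kinf n a (x + Pi.single ρ 1, κ) (x' + Pi.single ρ' 1, κ) - G₀ (x' + Pi.single ρ' 1 - (x + Pi.single ρ 1)))
        - (Kinf n a (x, κ) (x' + Pi.single ρ' 1, κ) - G₀ (x' + Pi.single ρ' 1 - x)))
      - ((Kinf n a (x + Pi.single ρ 1, κ) (x', κ) - G₀ (x' - (x + Pi.single ρ 1))) - (Kinf n a (x, κ) (x', κ) - G₀ (x' - x)))| ≤
      (woodburyD2c 0 + ellD2 4 a) / (n : ℝ) ^ 4 := by
  rw [Kinf_diag_eq_both n hn a κ, Kinf_diag_eq_right n hn a κ, Kinf_diag_eq_left n hn a κ, Kinf_diag_eq n hn a κ]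
  have e : G₀ (x' + Pi.single ρ' 1 - (x + Pi.single ρ 1))
        - ((n : ℕ) : ℝ) ^ 2 * (RperpBLim n a 0 κ (WoodburySymbol.bump ρ (repO n x x')) (WoodburySymbol.bump ρ' (repS n x x'))).re
        + ((n : ℕ) : ℝ) ^ 2 * (LkerLim n a (repO n x x' + Pi.single ρ 1) κ (repS n x x' + Pi.single ρ' 1) κ).re
        - G₀ (x' + Pi.single ρ' 1 - (x + Pi.single ρ 1))
        - (G₀ (x' + Pi.single ρ' 1 - x) - ((n : ℕ) : ℝ) ^ 2 * (RperpBLim n a 0 κ (repO n x x') (WoodburySymbol.bump ρ' (repS n x x'))).re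
          + ((n : ℕ) : ℝ) ^ 2 * (LkerLim n a (repO n x x') κ (repS n x x' + Pi.single ρ' 1) κ).re - G₀ (x' + Pi.single ρ' 1 - x))
        - (G₀ (x' - (x + Pi.single ρ 1)) - ((n : ℕ) : ℝ) ^ 2 * (RperpBLim n a 0 κ (WoodburySymbol.bump ρ (repO n x x')) (repS n x x')).re
          + ((n : ℕ) : ℝ) ^ 2 * (LkerLim n a (repO n x x' + Pi.single ρ 1) κ (repS n x x') κ).re - G₀ (x' - (x + Pi.single ρ 1))
          - (G₀ (x' - x) - ((n : ℕ) : ℝ) ^ 2 * (RperpBLim n a 0 κ (repO n x x') (repS n x x')).re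
            + ((n : ℕ) : ℝ) ^ 2 * (LkerLim n a (repO n x x') κ (repS n x x') κ).re - G₀ (x' - x)))
      = -(((n : ℕ) : ℝ) ^ 2 * (ddRperpBLim n a 0 κ ρ ρ' (repO n x x') (repS n x x')).re)
        + ((n : ℕ) : ℝ) ^ 2 * ((LkerLim n a (repO n x x' + Pi.single ρ 1) κ (repS n x x' + Pi.single ρ' 1) κ
            - LkerLim n a (repO n x x') κ (repS n x x' + Pi.single ρ' 1) κ)
          - (LkerLim n a (repO n x x' + Pi.single ρ 1) κ (repS n x x') κ - LkerLim n a (repO n x x') κ (repS n x x') κ)).re := by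
    simp only [ddRperpBLim, Complex.sub_re, Complex.add_re]; ring
  rw [e]
  refine (abs_flat_le n (norm_ddRperpBLim_le n hn ha le_rfl κ ρ ρ' _ _) (norm_LkerLim_sub_sub_le n (by norm_num) hn ha ρ ρ' _ κ _ κ)).trans ?_
  rw [← add_div, show ((n : ℝ)) ^ (6 : ℕ) = (n : ℝ) ^ (4 + 2) from rfl, show ((n : ℝ)) ^ (4 + 2 : ℕ) = (n : ℝ) ^ (4 + 2) from rfl,
    sq_mul_div_pow_add_two]

end Flat

/-! ## §3 Per base point, on the window: the diagonal leg is `Leg`-graded with `n`-free constants -/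

section Window

variable (n : ℕ) [NeZero n] (hn : 1 ≤ n) {a : ℝ} (ha : 0 < a) (κ : Fin 4)
include hn ha

/-- [folklore] **THE DIAGONAL LEG IS GRADED OF DEGREE 2 ON THE WINDOW, n-FREE**: for `w ≠ 0`, `‖w‖∞ ≤ n`,
`|K^∞((b,κ),(b+w,κ))| ≤ (freeLeg.A + freeLeg.B + woodburyDc 0 + ellD0 4 a)/‖w‖∞²` — the `hG` hypothesis (`b = 2`) of `FlatGradedCount`. -/
theorem abs_Kinf_diag_le_window (b w : Pt) (hw : w ≠ 0) (hwn : supNorm w ≤ n) :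
    |Kinf n a (b, κ) (b + w, κ)| ≤ (freeLeg.A + freeLeg.B + woodburyDc 0 + ellD0 4 a) / (supNorm w : ℝ) ^ 2 := by
  have hfree : |G₀ w| ≤ (freeLeg.A + freeLeg.B) / (supNorm w : ℝ) ^ 2 := by
    have h := Leg.abs_f_le freeLeg 0 0 hw
    rwa [BubbleTransfer.freeLeg_f, BubbleTransfer.freeLeg_a] at h
  have hflat := abs_Kinf_diag_sub_G₀_le n hn ha κ b (b + w)
  rw [add_sub_cancel_left] at hflat
  have hC : 0 ≤ woodburyDc 0 + ellD0 4 a := add_nonneg woodburyDc_zero_nonneg (ellD0_nonneg ha)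
  have hflat' := hflat.trans (div_pow_le_div_supNorm_pow hC hw hwn 2)
  calc |Kinf n a (b, κ) (b + w, κ)| = |(Kinf n a (b, κ) (b + w, κ) - G₀ w) + G₀ w| := by rw [sub_add_cancel]
    _ ≤ |Kinf n a (b, κ) (b + w, κ) - G₀ w| + |G₀ w| := abs_add_le _ _
    _ ≤ (woodburyDc 0 + ellD0 4 a) / (supNorm w : ℝ) ^ 2 + (freeLeg.A + freeLeg.B) / (supNorm w : ℝ) ^ 2 := add_le_add hflat' hfree
    _ = (freeLeg.A + freeLeg.B + woodburyDc 0 + ellD0 4 a) / (supNorm w : ℝ) ^ 2 := by ring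

/-- [folklore] **THE FAR-END DIFFERENCE OF THE DIAGONAL LEG IS GRADED OF DEGREE 3 ON THE WINDOW, n-FREE**: for `w ≠ 0`, `‖w‖∞ ≤ n`,
`|K^∞((b,κ),(b+w+e_ρ,κ)) − K^∞((b,κ),(b+w,κ))| ≤ ((gradLegFwd ρ).A + (gradLegFwd ρ).B + woodburyD1c 0 + ellD1 4 a)/‖w‖∞³` (`b = 3`). -/
theorem abs_Kinf_diag_sub_disp_le_window (ρ : Fin 4) (b w : Pt) (hw : w ≠ 0) (hwn : supNorm w ≤ n) :
    |Kinf n a (b, κ) (b + w + Pi.single ρ 1, κ) - Kinf n a (b, κ) (b + w, κ)| ≤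
      ((gradLegFwd ρ).A + (gradLegFwd ρ).B + woodburyD1c 0 + ellD1 4 a) / (supNorm w : ℝ) ^ 3 := by
  have hfree : |G₀ (w + Pi.single ρ 1) - G₀ w| ≤ ((gradLegFwd ρ).A + (gradLegFwd ρ).B) / (supNorm w : ℝ) ^ 3 := by
    have h := Leg.abs_f_le (gradLegFwd ρ) 0 0 hw
    rw [BubbleTransfer.gradLegFwd_a] at h
    have e : (gradLegFwd ρ).f 0 0 w = G₀ (w + Pi.single ρ 1) - G₀ w := by
      show (Literature.Probability.LatticeModels.latticeGreen (w + Pi.single ρ 1) - Literature.Probability.LatticeModels.latticeGreen w) / 2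
        = Literature.Probability.LatticeModels.latticeGreen (w + Pi.single ρ 1) / 2 - Literature.Probability.LatticeModels.latticeGreen w / 2
      ring
    rwa [e] at h
  have hflat := abs_Kinf_diag_flat_sub_right_le n hn ha κ ρ b (b + w)
  rw [add_sub_cancel_left, show b + w + Pi.single ρ 1 - b = w + Pi.single ρ 1 by abel] at hflat
  have hC : 0 ≤ woodburyD1c 0 + ellD1 4 a := add_nonneg woodburyD1c_zero_nonneg (ellD1_nonneg ha)
  have hflat' := hflat.trans (div_pow_le_div_supNorm_pow hC hw hwn 3)
  calc |Kinf n a (b, κ) (b + w + Pi.single ρ 1, κ) - Kinf n a (b, κ) (b + w, κ)|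
      = |((Kinf n a (b, κ) (b + w + Pi.single ρ 1, κ) - G₀ (w + Pi.single ρ 1)) - (Kinf n a (b, κ) (b + w, κ) - G₀ w))
          + (G₀ (w + Pi.single ρ 1) - G₀ w)| := by ring_nf
    _ ≤ |(Kinf n a (b, κ) (b + w + Pi.single ρ 1, κ) - G₀ (w + Pi.single ρ 1)) - (Kinf n a (b, κ) (b + w, κ) - G₀ w)|
          + |G₀ (w + Pi.single ρ 1) - G₀ w| := abs_add_le _ _
    _ ≤ (woodburyD1c 0 + ellD1 4 a) / (supNorm w : ℝ) ^ 3 + ((gradLegFwd ρ).A + (gradLegFwd ρ).B) / (supNorm w : ℝ) ^ 3 :=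
        add_le_add hflat' hfree
    _ = ((gradLegFwd ρ).A + (gradLegFwd ρ).B + woodburyD1c 0 + ellD1 4 a) / (supNorm w : ℝ) ^ 3 := by ring

end Window

end Summit.QuantumFields.BalabanUV.Beta.D1BFx.DiagonalLegGrade
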